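import Mathlib.Algebra.MvPolynomial.Funext
import Mathlib.Algebra.MvPolynomial.Monad
import Literature.Computability.AlgebraicComplexity.BILPS19MinrankVarieties
import Literature.Computability.AlgebraicComplexity.KV20NonRigidEquationsProofs
import HarnessLib

/-!
# Bläser–Ikenmeyer–Lysikov–Pandey–Schreyer 2019, §8.2–§8.3: the rank-one pencil charts of the
# minrank variety `𝓜_1`, and the vanishing criterion behind the PIT verification of Thm 40 / Cor 42

Topic `Literature/Computability/AlgebraicComplexity` (val-lit X5-BILPS19, §8.3 residue `BILPS2019_cor42`).
Source: M. Bläser, C. Ikenmeyer, V. Lysikov, A. Pandey, F.-O. Schreyer, *Variety membership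
testing, algebraic natural proofs, and geometric complexity theory*, arXiv:1911.02534
[BlaserIkenmeyerLysikovPandeySchreyer2019], §8.3: Def 39 ("uniformly generated": a dense polynomial
parametrisation `g` of `V_n`), Thm 40 (proof, p0035:L1–L20: "use polynomial identity testing to
check whether `C(g_1, …, g_{p(n)})` is identically zero … since the image of `(g_1, …, g_{p(n)})`
lies in `V_n` …"), Lemma 41 and its Remark (minrank varieties are uniformly generated via the orbit
closures of Thm 19), Cor 42 (the minrank barrier).

WHAT THIS FILE PROVES (the algebraic half of the PIT step of Thm 40 for the variety `𝓜_1`, i.e. the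
variety of the NP-hard problem `HMinRank1` of Cor 35; OUR charts, DISCLOSED: the print parametrises
`𝓜_r` densely by the orbit map of `T_{k,n,r}` (Lemma 41); for `r = 1` we use instead the `k`
RANK-ONE PENCIL CHARTS `φ_{a₀}`, `a₀ < k`,
`φ_{a₀}(S, x, u, v) = (S with slice a₀ replaced by u vᵀ − Σ_{a ≠ a₀} x_a S_a)`,
whose images COVER `𝓜_1(F)` EXACTLY over every field — "`rk(Tx) ≤ 1` iff `Tx = u vᵀ`", with
`x` normalised to `x_{a₀} = 1` — so that no density argument is needed):

* `mem_minrankSet_one_iff_exists_pencilPt`: `T ∈ 𝓜_1 ↔ ∃ a₀ q, T = φ_{a₀}(q)` (every field);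
* `vanishes_on_minrankSet_one_iff`: for `F` infinite, a polynomial `p` vanishes on `𝓜_1(F)` iff all
  `k` substituted polynomials `Φ_{a₀} p` (`Φ_{a₀} = bind₁ (pencilGen a₀)`, the algebra map of the
  chart) are ZERO POLYNOMIALS — the statement "`C(g_1, …, g_{p(n)})` is identically zero" that the
  `∃BPP` verifier of Thm 40 tests by PIT;
* `map_vanishes_on_minrankSet_one_iff`: the same for an INTEGER polynomial `P` read in a field of
  characteristic `0` (the constant-free certificates of Cor 42 compute integer polynomials): `P`
  vanishes on `𝓜_1(F)` iff the `k` integer polynomials `Φ_{a₀} P` vanish identically — i.e. iff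
  their circuits are yes-instances of `PITLanguage`.

Consumer: the conditional edge `PITLanguage ∈ BPP → BILPS2019_cor42` (val-lit X5 residue; the
Boolean `∃BPP` frame is the sibling of `BIJL2018_thm5`'s), where these three statements are exactly
what the verifier's correctness needs on the algebraic side. Theorem-only file (its `def`s are proof
plumbing: the chart generators and maps). Provenance (val-lit): text written and farm-checked by seat
val-lit-t19 g7 (banked 2026-08-27T06:36Z), filed unchanged by seat val-lit-x5 g5 as the first piece of
the cor42 edge. HONEST FRAMING (val-lit): elementary linear algebra over the tree's `minrankSet`;
`VP ≠ VNP` is NOT proved and nothing here bears on it.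

## References

* [BlaserIkenmeyerLysikovPandeySchreyer2019] arXiv:1911.02534, §8.3 Def. 39, Thm. 40 (proof,
  p0035:L1–L20), Lemma 41 + Remark (p0035:L23–L33), Cor. 42 (p0035:L37).
-/

noncomputable section

open MvPolynomial Matrix

namespace Literature.Computability.AlgebraicComplexity

namespace BILPS2019MinrankOne

/-! ### The rank-one pencil charts -/

section Charts

variable (R : Type*) [CommRing R] (k n : ℕ)

/-- Parameters of a chart: all slice entries `S_{abc}` (the slice `a₀` is unused), the pencil
coefficients `x_a`, and the rank-one factors `u_b`, `v_c`.
[cite: BlaserIkenmeyerLysikovPandeySchreyer2019, Def. 39 (the parameters of a parametrisation)] -/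
abbrev PencilParams : Type := (Fin k × Fin n × Fin n) ⊕ (Fin k ⊕ (Fin n ⊕ Fin n))

/-- **The generators of the chart `φ_{a₀}`**: coordinate `(a, b, c)` of the tensor is `S_{abc}` for
`a ≠ a₀` and `u_b v_c − Σ_{a ≠ a₀} x_a S_{abc}` for `a = a₀`.
[cite: BlaserIkenmeyerLysikovPandeySchreyer2019, Thm. 40 (proof: the parametrisation g_1, …, g_{p(n)})] -/
def pencilGen (a₀ : Fin k) (i : Fin k × Fin n × Fin n) : MvPolynomial (PencilParams k n) R :=
  if i.1 = a₀ then
    X (Sum.inr (Sum.inr (Sum.inl i.2.1))) * X (Sum.inr (Sum.inr (Sum.inr i.2.2))) -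
      ∑ a ∈ Finset.univ.erase a₀, X (Sum.inr (Sum.inl a)) * X (Sum.inl (a, i.2.1, i.2.2))
  else X (Sum.inl i)

/-- **The substitution `Φ_{a₀} : p ↦ p(g_1, …, g_{p(n)})`** along the chart `φ_{a₀}` ("check whether
`C(g_1, …, g_{p(n)})` is identically zero"). [cite: BlaserIkenmeyerLysikovPandeySchreyer2019, Thm. 40 (proof)] -/
def pencilSubst (a₀ : Fin k) :
    MvPolynomial (Fin k × Fin n × Fin n) R →ₐ[R] MvPolynomial (PencilParams k n) R :=
  bind₁ (pencilGen R k n a₀)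

/-- **The chart `φ_{a₀}`** on points: parameters `q` to the point of the tensor.
[cite: BlaserIkenmeyerLysikovPandeySchreyer2019, Thm. 40 (proof)] -/
def pencilPt (a₀ : Fin k) (q : PencilParams k n → R) : Fin k × Fin n × Fin n → R :=
  fun i => eval q (pencilGen R k n a₀ i)

variable {R k n}

/-- Entries of the chart. [cite: BlaserIkenmeyerLysikovPandeySchreyer2019, Thm. 40 (proof)] -/
theorem pencilPt_apply (a₀ : Fin k) (q : PencilParams k n → R) (a : Fin k) (b c : Fin n) :
    pencilPt R k n a₀ q (a, b, c) =
      if a = a₀ then q (Sum.inr (Sum.inr (Sum.inl b))) * q (Sum.inr (Sum.inr (Sum.inr c))) -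
        ∑ a' ∈ Finset.univ.erase a₀, q (Sum.inr (Sum.inl a')) * q (Sum.inl (a', b, c))
      else q (Sum.inl (a, b, c)) := by
  unfold pencilPt pencilGen
  split_ifs <;> simp

/-- Evaluating the substituted polynomial is evaluating at the chart point:
`(Φ_{a₀} p)(q) = p(φ_{a₀}(q))`. [cite: BlaserIkenmeyerLysikovPandeySchreyer2019, Thm. 40 (proof)] -/
theorem eval_pencilSubst (a₀ : Fin k) (q : PencilParams k n → R) (p : MvPolynomial (Fin k × Fin n × Fin n) R) :
    eval q (pencilSubst R k n a₀ p) = eval (pencilPt R k n a₀ q) p := by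
  induction p using MvPolynomial.induction_on with
  | C r => simp [pencilSubst]
  | add p₁ p₂ h₁ h₂ => simp only [map_add, h₁, h₂]
  | mul_X p₁ i h₁ => rw [map_mul, map_mul, h₁, map_mul, eval_X, pencilSubst, bind₁_X_right]; rfl

end Charts

/-! ### The charts cover `𝓜_1` exactly -/

section Cover

variable {F : Type*} [Field F] {k n : ℕ}

/-- Scaling the form scales the contraction. [cite: BlaserIkenmeyerLysikovPandeySchreyer2019, §5 (before Def. 13)] -/
theorem contract3_smul (T : Fin k → Fin n → Fin n → F) (c : F) (x : Fin k → F) :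
    contract3 T (c • x) = c • contract3 T x := by
  ext b d
  simp only [contract3_apply, Pi.smul_apply, smul_eq_mul, Matrix.smul_apply, Finset.mul_sum, mul_assoc]

/-- **The rank-one pencil charts cover `𝓜_1` exactly**: `T ∈ 𝓜_1` iff `T = φ_{a₀}(q)` for some
chart `a₀` and parameters `q` ("`rk(Tx) ≤ 1`" iff "`Tx = u vᵀ`", with the witness `x` normalised
to `x_{a₀} = 1`). [cite: BlaserIkenmeyerLysikovPandeySchreyer2019, Thm. 40 (proof: "the image of (g_1, …, g_{p(n)}) lies in V_n") and Def. 15] -/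
theorem mem_minrankSet_one_iff_exists_pencilPt (T : Fin k → Fin n → Fin n → F) :
    T ∈ (minrankSet F 1 : Set (Fin k → Fin n → Fin n → F)) ↔
      ∃ (a₀ : Fin k) (q : PencilParams k n → F), trilinearPt T = pencilPt F k n a₀ q := by
  constructor
  · rintro ⟨x, hx, hr⟩
    obtain ⟨a₀, ha₀⟩ : ∃ a₀, x a₀ ≠ 0 := Function.ne_iff.1 hx
    -- normalise the witness to `x_{a₀} = 1`
    set x' : Fin k → F := (x a₀)⁻¹ • x with hx'
    have hx'a : x' a₀ = 1 := by simp [hx', inv_mul_cancel₀ ha₀]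
    have hr' : (contract3 T x').rank ≤ 1 := by
      rw [hx', contract3_smul]
      have h1 : (x a₀)⁻¹ • contract3 T x = ((x a₀)⁻¹ • (1 : Matrix (Fin n) (Fin n) F)) * contract3 T x := by
        rw [Matrix.smul_mul, Matrix.one_mul]
      rw [h1]
      exact (Matrix.rank_mul_le_right _ _).trans hr
    obtain ⟨U, V, hUV⟩ := KumarVolk2020.exists_mul_eq_of_rank_le (contract3 T x') hr'
    refine ⟨a₀, Sum.elim (fun i => T i.1 i.2.1 i.2.2)
      (Sum.elim x' (Sum.elim (fun b => U b 0) (fun c => V 0 c))), ?_⟩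
    funext ⟨a, b, c⟩
    rw [pencilPt_apply]
    by_cases ha : a = a₀
    · rw [if_pos ha]
      simp only [Sum.elim_inr, Sum.elim_inl]
      have hUVbc : U b 0 * V 0 c = contract3 T x' b c := by
        rw [← hUV, Matrix.mul_apply, Fin.sum_univ_one]
      rw [hUVbc, contract3_apply, ← Finset.add_sum_erase Finset.univ _ (Finset.mem_univ a₀), hx'a, one_mul,
        ha]
      simp [trilinearPt]
    · rw [if_neg ha]
      rfl
  · rintro ⟨a₀, q, hq⟩
    set xv : Fin k → F := fun a => if a = a₀ then 1 else q (Sum.inr (Sum.inl a)) with hxv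
    have hx0 : xv a₀ = 1 := by simp [hxv]
    refine ⟨xv, fun h => ?_, ?_⟩
    · have := congr_fun h a₀
      rw [hx0] at this
      exact one_ne_zero this
    · have hT : ∀ a b c, T a b c = pencilPt F k n a₀ q (a, b, c) := fun a b c => congr_fun hq (a, b, c)
      have hc : contract3 T xv =
          Matrix.vecMulVec (fun b => q (Sum.inr (Sum.inr (Sum.inl b)))) (fun c => q (Sum.inr (Sum.inr (Sum.inr c)))) := by
        ext b c
        have hsplit := Finset.add_sum_erase Finset.univ (fun a => xv a * T a b c) (Finset.mem_univ a₀)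
        have hrest : ∑ a ∈ Finset.univ.erase a₀, xv a * T a b c =
            ∑ a ∈ Finset.univ.erase a₀, q (Sum.inr (Sum.inl a)) * q (Sum.inl (a, b, c)) := by
          refine Finset.sum_congr rfl fun a ha => ?_
          have ha' : a ≠ a₀ := (Finset.mem_erase.1 ha).1
          have hxa : xv a = q (Sum.inr (Sum.inl a)) := by simp [hxv, ha']
          rw [hxa, hT a b c, pencilPt_apply, if_neg ha']
        have ha0 : T a₀ b c = q (Sum.inr (Sum.inr (Sum.inl b))) * q (Sum.inr (Sum.inr (Sum.inr c))) -
            ∑ a ∈ Finset.univ.erase a₀, q (Sum.inr (Sum.inl a)) * q (Sum.inl (a, b, c)) := by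
          rw [hT a₀ b c, pencilPt_apply, if_pos rfl]
        rw [contract3_apply, ← hsplit, hx0, one_mul, hrest, ha0, Matrix.vecMulVec_apply]
        ring
      rw [hc]
      exact Matrix.rank_vecMulVec_le _ _

end Cover

/-! ### The vanishing criterion (the PIT step of Thm 40 for `𝓜_1`) -/

section Vanishing

variable {F : Type*} [Field F] {k n : ℕ}

/-- **A polynomial vanishes on `𝓜_1(F)` iff its `k` chart substitutions are zero polynomials**
(`F` infinite): "use polynomial identity testing to check whether `C(g_1, …, g_{p(n)})` is
identically zero". [cite: BlaserIkenmeyerLysikovPandeySchreyer2019, Thm. 40 (proof, steps 3–4)] -/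
theorem vanishes_on_minrankSet_one_iff [Infinite F] (p : MvPolynomial (Fin k × Fin n × Fin n) F) :
    (∀ T : Fin k → Fin n → Fin n → F, T ∈ (minrankSet F 1 : Set (Fin k → Fin n → Fin n → F)) →
        eval (trilinearPt T) p = 0) ↔
      ∀ a₀ : Fin k, pencilSubst F k n a₀ p = 0 := by
  constructor
  · intro h a₀
    refine MvPolynomial.funext fun q => ?_
    rw [eval_pencilSubst, map_zero]
    have hpt : trilinearPt (fun a b c => pencilPt F k n a₀ q (a, b, c)) = pencilPt F k n a₀ q :=
      funext fun ⟨a, b, c⟩ => rfl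
    rw [← hpt]
    exact h _ ((mem_minrankSet_one_iff_exists_pencilPt _).2 ⟨a₀, q, hpt⟩)
  · intro h T hT
    obtain ⟨a₀, q, hq⟩ := (mem_minrankSet_one_iff_exists_pencilPt T).1 hT
    rw [hq, ← eval_pencilSubst, h a₀, map_zero]

/-- The chart generators are defined over `ℤ`: `map` carries the integer generators to those over
`F`. [cite: BlaserIkenmeyerLysikovPandeySchreyer2019, Thm. 40 (proof)] -/
theorem map_pencilGen (a₀ : Fin k) (i : Fin k × Fin n × Fin n) :
    map (Int.castRingHom F) (pencilGen ℤ k n a₀ i) = pencilGen F k n a₀ i := by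
  unfold pencilGen
  split_ifs <;> simp [map_sum]

/-- The chart substitution commutes with reading an integer polynomial in `F`.
[cite: BlaserIkenmeyerLysikovPandeySchreyer2019, Thm. 40 (proof)] -/
theorem map_pencilSubst (a₀ : Fin k) (P : MvPolynomial (Fin k × Fin n × Fin n) ℤ) :
    map (Int.castRingHom F) (pencilSubst ℤ k n a₀ P) = pencilSubst F k n a₀ (map (Int.castRingHom F) P) := by
  rw [pencilSubst, pencilSubst, map_bind₁,
    show (fun i => map (Int.castRingHom F) (pencilGen ℤ k n a₀ i)) = pencilGen F k n a₀ from
      funext (map_pencilGen a₀)]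

/-- **Integer form, characteristic `0`** (the certificates of Cor 42 are constant-free, hence compute
integer polynomials): an integer polynomial read in `F` vanishes on `𝓜_1(F)` iff its `k` INTEGER
chart substitutions are zero polynomials — i.e. iff their circuits are yes-instances of PIT over `ℤ`.
[cite: BlaserIkenmeyerLysikovPandeySchreyer2019, Thm. 40 (proof) and Cor. 42] -/
theorem map_vanishes_on_minrankSet_one_iff [CharZero F] (P : MvPolynomial (Fin k × Fin n × Fin n) ℤ) :
    (∀ T : Fin k → Fin n → Fin n → F, T ∈ (minrankSet F 1 : Set (Fin k → Fin n → Fin n → F)) →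
        eval (trilinearPt T) (map (Int.castRingHom F) P) = 0) ↔
      ∀ a₀ : Fin k, pencilSubst ℤ k n a₀ P = 0 := by
  haveI : Infinite F := Infinite.of_injective _ Nat.cast_injective
  rw [vanishes_on_minrankSet_one_iff]
  refine forall_congr' fun a₀ => ?_
  rw [← map_pencilSubst, ← (map_injective (Int.castRingHom F) Int.cast_injective).eq_iff, map_zero]

end Vanishing

end BILPS2019MinrankOne

end Literature.Computability.AlgebraicComplexity
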